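import Mathlib.Analysis.InnerProductSpace.l2Space
import Mathlib.Analysis.SpecialFunctions.Pow.Real
import Literature.Analysis.OperatorTheory.HilbertSchmidtOrthogonalSum
import HarnessLib

/-!
# Temple's inequality for a symmetric operator with an eigenbasis, and the second level from the
# negative square mass (Reed–Simon IV, Thm. XIII.5; Kato, *Perturbation theory*, §VI)

Topic `Analysis/OperatorTheory`; theorems only (no definition, no named fact, no instance).

Setting: an inner product space `E` over `𝕜 = ℝ` or `ℂ`, a Hilbert basis `(e_i)` of `E` consisting
of eigenvectors of a symmetric map `T : E → E`, `T e_i = λ_i e_i` with real `λ_i` (for instance a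
compact self-adjoint operator, or its restriction to a closed invariant subspace). For `x ∈ E` write
`ρ = Re ⟪x, T x⟫` (Rayleigh quotient when `‖x‖ = 1`) and `‖T x‖²`.

* `inner_hilbertBasis_eigen` — `⟪e_i, T x⟫ = λ_i ⟪e_i, x⟫`.
* `hasSum_eigen_norm_sq`, `hasSum_eigen_sq_norm_sq` — `Σ λ_i |⟪e_i,x⟫|² = Re ⟪x,Tx⟫`,
  `Σ λ_i² |⟪e_i,x⟫|² = ‖Tx‖²`.
* `exists_eigenvalue_le_rayleigh` — **Ritz**: for a unit vector some `λ_i` with `⟪e_i,x⟫ ≠ 0` is `≤ ρ`.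
* `temple_core` — if every `λ_i` lies outside `(l, β)` and `l ≤ β` then
  `(l + β) ρ ≤ ‖Tx‖² + l β ‖x‖²` (the sum `Σ |⟪e_i,x⟫|² (λ_i − l)(λ_i − β) ≥ 0`);
  `temple_inequality` — **Temple**: for a unit vector with `ρ < β`,
  `l ≥ ρ − (‖Tx‖² − ρ²)/(β − ρ)`. [cite: ReedSimonIV1978, Thm. XIII.5]
* `eigenvalue_ge_neg_sqrt_of_negSqMass_le` — if the finite partial sums of `Σ_{λ_i<0} λ_i²` are `≤ S`
  and `λ_{i₀} ≤ ρ ≤ 0`, then every other eigenvalue is `≥ −√(S − ρ²)` (the would-be second negative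
  eigenvalue cannot carry more square mass than `S − λ_{i₀}²`). [folklore]
* `rayleigh_ge_temple_of_negSqMass_le` — the packaged **a-posteriori lower bound for the bottom of the
  form**: with `β := −√(S − ρ²)` and `ρ < β` (so at most one eigenvalue lies below `β`), every `y` has
  `Re ⟪y, T y⟫ ≥ (ρ − (‖Tx‖² − ρ²)/(β − ρ)) ‖y‖²`. This is the form in which certified numerics
  (a Ritz value `ρ`, a residual bound `‖Tx‖² − ρ²`, and a Hilbert–Schmidt-type bound `S` on the
  negative square mass) bound the lowest eigenvalue of a compact symmetric kernel from below.

## References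
* M. Reed, B. Simon, *Methods of Modern Mathematical Physics IV: Analysis of Operators* (1978),
  Thm. XIII.5 (Temple's inequality) [ReedSimonIV1978].
* T. Kato, *Perturbation Theory for Linear Operators* (1966), §VI.
-/

noncomputable section

open scoped InnerProductSpace ComplexConjugate
open Filter Topology

namespace Literature.Analysis.OperatorTheory

variable {𝕜 : Type*} [RCLike 𝕜] {E : Type*} [NormedAddCommGroup E] [InnerProductSpace 𝕜 E]

section Eigenbasis

variable {ι : Type*} (b : HilbertBasis ι 𝕜 E) {T : E → E} {ev : ι → ℝ}

/-- For a symmetric `T` with `T e_i = λ_i e_i` (`λ_i` real): `⟪e_i, T x⟫ = λ_i ⟪e_i, x⟫`. [folklore] -/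
theorem inner_hilbertBasis_eigen (hsym : ∀ x y : E, ⟪T x, y⟫_𝕜 = ⟪x, T y⟫_𝕜)
    (hT : ∀ i, T (b i) = (ev i : 𝕜) • b i) (x : E) (i : ι) :
    ⟪b i, T x⟫_𝕜 = (ev i : 𝕜) * ⟪b i, x⟫_𝕜 := by
  rw [← hsym, hT, inner_smul_left, RCLike.conj_ofReal]

/-- `Σ_i λ_i |⟪e_i, x⟫|² = Re ⟪x, T x⟫`. [folklore] -/
theorem hasSum_eigen_norm_sq (hsym : ∀ x y : E, ⟪T x, y⟫_𝕜 = ⟪x, T y⟫_𝕜)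
    (hT : ∀ i, T (b i) = (ev i : 𝕜) • b i) (x : E) :
    HasSum (fun i => ev i * ‖⟪b i, x⟫_𝕜‖ ^ 2) (RCLike.re ⟪x, T x⟫_𝕜) := by
  have h := (b.hasSum_inner_mul_inner x (T x)).map RCLike.re RCLike.continuous_re
  convert h using 1
  funext i
  simp only [Function.comp_apply]
  rw [inner_hilbertBasis_eigen b hsym hT x i, ← inner_conj_symm x (b i), ← mul_assoc,
    mul_comm (conj ⟪b i, x⟫_𝕜), mul_assoc, RCLike.conj_mul, ← RCLike.ofReal_pow,
    ← RCLike.ofReal_mul, RCLike.ofReal_re]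

/-- `Σ_i λ_i² |⟪e_i, x⟫|² = ‖T x‖²`. [folklore] -/
theorem hasSum_eigen_sq_norm_sq (hsym : ∀ x y : E, ⟪T x, y⟫_𝕜 = ⟪x, T y⟫_𝕜)
    (hT : ∀ i, T (b i) = (ev i : 𝕜) • b i) (x : E) :
    HasSum (fun i => ev i ^ 2 * ‖⟪b i, x⟫_𝕜‖ ^ 2) (‖T x‖ ^ 2) := by
  have h := hasSum_norm_inner_sq b (T x)
  convert h using 1
  funext i
  rw [inner_hilbertBasis_eigen b hsym hT x i, norm_mul, RCLike.norm_ofReal, mul_pow, sq_abs]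

/-- **Ritz**: for a unit vector `x`, some eigenvalue `λ_i` with `⟪e_i, x⟫ ≠ 0` satisfies
`λ_i ≤ Re ⟪x, T x⟫`. [folklore] -/
theorem exists_eigenvalue_le_rayleigh (hsym : ∀ x y : E, ⟪T x, y⟫_𝕜 = ⟪x, T y⟫_𝕜)
    (hT : ∀ i, T (b i) = (ev i : 𝕜) • b i) {x : E} (hx : ‖x‖ = 1) :
    ∃ i, ⟪b i, x⟫_𝕜 ≠ 0 ∧ ev i ≤ RCLike.re ⟪x, T x⟫_𝕜 := by
  by_contra hcon
  push Not at hcon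
  set ρ := RCLike.re ⟪x, T x⟫_𝕜 with hρ
  have h1 : HasSum (fun i => ‖⟪b i, x⟫_𝕜‖ ^ 2) 1 := by
    have := hasSum_norm_inner_sq b x; rwa [hx, one_pow] at this
  have h2 := hasSum_eigen_norm_sq b hsym hT x
  -- some coefficient is non-zero
  obtain ⟨i₀, hi₀⟩ : ∃ i, ⟪b i, x⟫_𝕜 ≠ 0 := by
    by_contra hall; push Not at hall
    have : HasSum (fun i => ‖⟪b i, x⟫_𝕜‖ ^ 2) 0 := by
      have h0 : (fun i => ‖⟪b i, x⟫_𝕜‖ ^ 2) = fun _ => (0:ℝ) := by funext i; simp [hall i]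
      rw [h0]; exact hasSum_zero
    exact one_ne_zero (h1.unique this)
  have hle : ∀ i, ρ * ‖⟪b i, x⟫_𝕜‖ ^ 2 ≤ ev i * ‖⟪b i, x⟫_𝕜‖ ^ 2 := by
    intro i
    by_cases hc : ⟪b i, x⟫_𝕜 = 0
    · simp [hc]
    · exact mul_le_mul_of_nonneg_right (hcon i hc).le (sq_nonneg _)
  have hlt : ρ * ‖⟪b i₀, x⟫_𝕜‖ ^ 2 < ev i₀ * ‖⟪b i₀, x⟫_𝕜‖ ^ 2 :=
    mul_lt_mul_of_pos_right (hcon i₀ hi₀) (by positivity)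
  have := hasSum_lt hle hlt (h1.mul_left ρ) h2
  rw [mul_one] at this
  exact lt_irrefl _ this

/-- **Temple, division-free core**: if every eigenvalue lies outside the open interval `(l, β)` and
`l ≤ β`, then `(l + β) Re⟪x,Tx⟫ ≤ ‖Tx‖² + l β ‖x‖²` (because `Σ_i |⟪e_i,x⟫|² (λ_i − l)(λ_i − β) ≥ 0`).
[cite: ReedSimonIV1978, Thm. XIII.5] -/
theorem temple_core (hsym : ∀ x y : E, ⟪T x, y⟫_𝕜 = ⟪x, T y⟫_𝕜)
    (hT : ∀ i, T (b i) = (ev i : 𝕜) • b i) {l β : ℝ} (hgap : ∀ i, ev i ≤ l ∨ β ≤ ev i)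
    (hlβ : l ≤ β) (x : E) :
    (l + β) * RCLike.re ⟪x, T x⟫_𝕜 ≤ ‖T x‖ ^ 2 + l * β * ‖x‖ ^ 2 := by
  have h0 := hasSum_norm_inner_sq b x
  have h1 := hasSum_eigen_norm_sq b hsym hT x
  have h2 := hasSum_eigen_sq_norm_sq b hsym hT x
  have hsum : HasSum (fun i => ‖⟪b i, x⟫_𝕜‖ ^ 2 * ((ev i - l) * (ev i - β)))
      (‖T x‖ ^ 2 - (l + β) * RCLike.re ⟪x, T x⟫_𝕜 + l * β * ‖x‖ ^ 2) := by
    have := (h2.sub (h1.mul_left (l + β))).add (h0.mul_left (l * β))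
    have hfun : (fun i => ‖⟪b i, x⟫_𝕜‖ ^ 2 * ((ev i - l) * (ev i - β))) =
        fun i => ev i ^ 2 * ‖⟪b i, x⟫_𝕜‖ ^ 2 - (l + β) * (ev i * ‖⟪b i, x⟫_𝕜‖ ^ 2)
          + l * β * ‖⟪b i, x⟫_𝕜‖ ^ 2 := by
      funext i; ring
    rw [hfun]; exact this
  have hnn : ∀ i, 0 ≤ ‖⟪b i, x⟫_𝕜‖ ^ 2 * ((ev i - l) * (ev i - β)) := by
    intro i
    refine mul_nonneg (sq_nonneg _) ?_
    rcases hgap i with h | h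
    · exact mul_nonneg_of_nonpos_of_nonpos (by linarith) (by linarith)
    · exact mul_nonneg (by linarith) (by linarith)
  have := hsum.nonneg hnn
  linarith

/-- **Temple's inequality**: for a unit vector `x` with `ρ = Re⟪x,Tx⟫ < β`, and all eigenvalues outside
`(l, β)`, `l ≤ β`: `ρ − (‖Tx‖² − ρ²)/(β − ρ) ≤ l`. Taking `l = λ₁` (lowest eigenvalue, `λ₁ ≤ ρ`) and
`β ≤ λ₂` this is the classical lower bound complementing the Ritz upper bound `λ₁ ≤ ρ`.
[cite: ReedSimonIV1978, Thm. XIII.5] -/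
theorem temple_inequality (hsym : ∀ x y : E, ⟪T x, y⟫_𝕜 = ⟪x, T y⟫_𝕜)
    (hT : ∀ i, T (b i) = (ev i : 𝕜) • b i) {l β : ℝ} (hgap : ∀ i, ev i ≤ l ∨ β ≤ ev i)
    (hlβ : l ≤ β) {x : E} (hx : ‖x‖ = 1) (hρβ : RCLike.re ⟪x, T x⟫_𝕜 < β) :
    RCLike.re ⟪x, T x⟫_𝕜 - (‖T x‖ ^ 2 - (RCLike.re ⟪x, T x⟫_𝕜) ^ 2) / (β - RCLike.re ⟪x, T x⟫_𝕜)
      ≤ l := by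
  have hc := temple_core b hsym hT hgap hlβ x
  rw [hx, one_pow, mul_one] at hc
  set ρ := RCLike.re ⟪x, T x⟫_𝕜
  have hβρ : 0 < β - ρ := sub_pos.2 hρβ
  rw [sub_le_iff_le_add, ← sub_le_iff_le_add', le_div_iff₀ hβρ]
  nlinarith [hc]

end Eigenbasis

/-- **Second level from the negative square mass**: if all finite partial sums of `Σ_{λ_i < 0} λ_i²`
are `≤ S` and `λ_{i₀} ≤ ρ ≤ 0`, then every eigenvalue with index `i ≠ i₀` is `≥ −√(S − ρ²)`.
[folklore] -/
theorem eigenvalue_ge_neg_sqrt_of_negSqMass_le {ι : Type*} {ev : ι → ℝ} {S ρ : ℝ} {i₀ : ι}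
    (hS : ∀ s : Finset ι, ∑ i ∈ s, (min (ev i) 0) ^ 2 ≤ S) (hρ : ev i₀ ≤ ρ) (hρ0 : ρ ≤ 0)
    {i : ι} (hi : i ≠ i₀) : -Real.sqrt (S - ρ ^ 2) ≤ ev i := by
  classical
  by_cases hpos : 0 ≤ ev i
  · exact le_trans (neg_nonpos.2 (Real.sqrt_nonneg _)) hpos
  push Not at hpos
  have h2 := hS {i, i₀}
  rw [Finset.sum_pair hi] at h2
  have hmi : min (ev i) 0 = ev i := min_eq_left hpos.le
  have hmi₀ : min (ev i₀) 0 = ev i₀ := min_eq_left (hρ.trans hρ0)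
  rw [hmi, hmi₀] at h2
  have hρsq : ρ ^ 2 ≤ ev i₀ ^ 2 := by nlinarith
  have hsq : ev i ^ 2 ≤ S - ρ ^ 2 := by linarith
  have habs : |ev i| ≤ Real.sqrt (S - ρ ^ 2) := by
    rw [← Real.sqrt_sq_eq_abs]; exact Real.sqrt_le_sqrt hsq
  linarith [neg_abs_le (ev i)]

/-- **A-posteriori lower bound for the bottom of the form (Ritz + Temple + negative square mass).**
`T` symmetric with a Hilbert eigenbasis `(e_i, λ_i)`; `x` a unit vector with `ρ = Re⟪x,Tx⟫ ≤ 0`; the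
finite partial sums of `Σ_{λ_i<0} λ_i²` bounded by `S`; `β := −√(S − ρ²)` with `ρ < β`. Then exactly as in
Temple's inequality with `λ₂ ≥ β`: for every `y`, `(ρ − (‖Tx‖² − ρ²)/(β − ρ)) ‖y‖² ≤ Re ⟪y, T y⟫`.
[cite: ReedSimonIV1978, Thm. XIII.5] -/
theorem rayleigh_ge_temple_of_negSqMass_le {ι : Type*} (b : HilbertBasis ι 𝕜 E) {T : E → E}
    {ev : ι → ℝ} (hsym : ∀ x y : E, ⟪T x, y⟫_𝕜 = ⟪x, T y⟫_𝕜) (hT : ∀ i, T (b i) = (ev i : 𝕜) • b i)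
    {S : ℝ} (hS : ∀ s : Finset ι, ∑ i ∈ s, (min (ev i) 0) ^ 2 ≤ S)
    {x : E} (hx : ‖x‖ = 1) (hρ0 : RCLike.re ⟪x, T x⟫_𝕜 ≤ 0)
    (hρβ : RCLike.re ⟪x, T x⟫_𝕜 < -Real.sqrt (S - (RCLike.re ⟪x, T x⟫_𝕜) ^ 2)) (y : E) :
    (RCLike.re ⟪x, T x⟫_𝕜 - (‖T x‖ ^ 2 - (RCLike.re ⟪x, T x⟫_𝕜) ^ 2) /
        (-Real.sqrt (S - (RCLike.re ⟪x, T x⟫_𝕜) ^ 2) - RCLike.re ⟪x, T x⟫_𝕜)) * ‖y‖ ^ 2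
      ≤ RCLike.re ⟪y, T y⟫_𝕜 := by
  set ρ := RCLike.re ⟪x, T x⟫_𝕜 with hρdef
  set β := -Real.sqrt (S - ρ ^ 2) with hβdef
  set lam := ρ - (‖T x‖ ^ 2 - ρ ^ 2) / (β - ρ) with hlam
  -- Ritz: an eigenvalue below ρ
  obtain ⟨i₀, -, hi₀⟩ := exists_eigenvalue_le_rayleigh b hsym hT hx
  -- all other eigenvalues are ≥ β
  have hothers : ∀ i, i ≠ i₀ → β ≤ ev i := fun i hi =>
    eigenvalue_ge_neg_sqrt_of_negSqMass_le hS hi₀ hρ0 hi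
  have hgap : ∀ i, ev i ≤ ev i₀ ∨ β ≤ ev i := by
    intro i
    by_cases hi : i = i₀
    · left; rw [hi]
    · right; exact hothers i hi
  have hlβ : ev i₀ ≤ β := hi₀.trans hρβ.le
  -- Temple for the bottom eigenvalue
  have htemple : lam ≤ ev i₀ := temple_inequality b hsym hT hgap hlβ hx hρβ
  -- lam ≤ β as well (lam ≤ ρ < β)
  have hres : 0 ≤ ‖T x‖ ^ 2 - ρ ^ 2 := by
    -- |ρ| ≤ |⟪x,Tx⟫| ≤ ‖x‖ ‖Tx‖ = ‖Tx‖
    have h1 : |ρ| ≤ ‖⟪x, T x⟫_𝕜‖ := RCLike.abs_re_le_norm _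
    have h2 : ‖⟪x, T x⟫_𝕜‖ ≤ ‖x‖ * ‖T x‖ := norm_inner_le_norm _ _
    rw [hx, one_mul] at h2
    have h3 : |ρ| ≤ ‖T x‖ := h1.trans h2
    nlinarith [abs_nonneg ρ, sq_abs ρ, norm_nonneg (T x)]
  have hlamρ : lam ≤ ρ := by
    have : 0 ≤ (‖T x‖ ^ 2 - ρ ^ 2) / (β - ρ) := div_nonneg hres (sub_pos.2 hρβ).le
    linarith
  have hall : ∀ i, lam ≤ ev i := by
    intro i
    by_cases hi : i = i₀
    · rw [hi]; exact htemple
    · exact (hlamρ.trans hρβ.le).trans (hothers i hi)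
  -- expand ⟪y, T y⟫ in the eigenbasis
  have h0 := hasSum_norm_inner_sq b y
  have h1 := hasSum_eigen_norm_sq b hsym hT y
  have hle : ∀ i, lam * ‖⟪b i, y⟫_𝕜‖ ^ 2 ≤ ev i * ‖⟪b i, y⟫_𝕜‖ ^ 2 := fun i =>
    mul_le_mul_of_nonneg_right (hall i) (sq_nonneg _)
  exact hasSum_le hle (h0.mul_left lam) h1

/-! ### Companions: negative square mass under a positive perturbation; eigenvector enclosure -/

section Companions

variable {ι : Type*} (b : HilbertBasis ι 𝕜 E) {T : E → E} {ev : ι → ℝ}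

/-- The eigenvalue is the diagonal matrix element: `λ_i = Re ⟪e_i, T e_i⟫`. [folklore] -/
theorem eigenvalue_eq_re_inner (hT : ∀ i, T (b i) = (ev i : 𝕜) • b i) (i : ι) :
    ev i = RCLike.re ⟪b i, T (b i)⟫_𝕜 := by
  rw [hT, inner_smul_right, inner_self_eq_norm_sq_to_K, b.orthonormal.norm_eq_one i]
  simp

/-- **Negative square mass under a positive perturbation.** If `B` is a positive form
(`0 ≤ Re ⟪y, B y⟫`), then for every finite set of indices
`Σ_{i∈s} (min λ_i 0)² ≤ Σ_{i∈s} ‖T e_i − B e_i‖²`: on an eigenvector with `λ_i < 0`,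
`Re⟪e_i, (T − B) e_i⟫ = λ_i − Re⟪e_i, B e_i⟫ ≤ λ_i < 0`, so `λ_i² ≤ |⟪e_i,(T−B)e_i⟩|² ≤ ‖(T−B)e_i‖²`.
With `Σ_i ‖(T − B) e_i‖² = ‖T − B‖²_HS` this bounds the negative square mass of `T` by the Hilbert–Schmidt
distance to ANY positive operator (used with an explicit finite-rank capture `B` of the positive part).
[folklore] -/
theorem sum_min_eigenvalue_sq_le_sum_norm_sub_sq (hT : ∀ i, T (b i) = (ev i : 𝕜) • b i)
    {B : E → E} (hB : ∀ y : E, 0 ≤ RCLike.re ⟪y, B y⟫_𝕜) (s : Finset ι) :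
    ∑ i ∈ s, (min (ev i) 0) ^ 2 ≤ ∑ i ∈ s, ‖T (b i) - B (b i)‖ ^ 2 := by
  refine Finset.sum_le_sum fun i _ => ?_
  by_cases hpos : 0 ≤ ev i
  · rw [min_eq_right hpos]; simp only [ne_eq, OfNat.ofNat_ne_zero, not_false_eq_true, zero_pow]; positivity
  push Not at hpos
  rw [min_eq_left hpos.le]
  have hev := eigenvalue_eq_re_inner b hT i
  have hre : RCLike.re ⟪b i, T (b i) - B (b i)⟫_𝕜 = ev i - RCLike.re ⟪b i, B (b i)⟫_𝕜 := by
    rw [inner_sub_right, map_sub, ← hev]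
  have hle : RCLike.re ⟪b i, T (b i) - B (b i)⟫_𝕜 ≤ ev i := by rw [hre]; linarith [hB (b i)]
  have hneg : RCLike.re ⟪b i, T (b i) - B (b i)⟫_𝕜 < 0 := hle.trans_lt hpos
  have h1 : |RCLike.re ⟪b i, T (b i) - B (b i)⟫_𝕜| ≤ ‖⟪b i, T (b i) - B (b i)⟫_𝕜‖ :=
    RCLike.abs_re_le_norm _
  have h2 : ‖⟪b i, T (b i) - B (b i)⟫_𝕜‖ ≤ ‖b i‖ * ‖T (b i) - B (b i)‖ := norm_inner_le_norm _ _
  rw [b.orthonormal.norm_eq_one i, one_mul] at h2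
  have h3 : |ev i| ≤ |RCLike.re ⟪b i, T (b i) - B (b i)⟫_𝕜| := by
    rw [abs_of_neg hpos, abs_of_neg hneg]; linarith
  have h4 : |ev i| ≤ ‖T (b i) - B (b i)‖ := h3.trans (h1.trans h2)
  nlinarith [abs_nonneg (ev i), sq_abs (ev i), norm_nonneg (T (b i) - B (b i))]

/-- **Eigenvector enclosure (Rayleigh–Ritz / Kato).** If all eigenvalues lie outside `(l, β)` and the
unit vector `x` has `l ≤ ρ = Re⟪x,Tx⟫ ≤ β`, then its mass on the eigenvalues `≥ β` is controlled by the
residual: for every finite set `s` of indices with `β ≤ λ_i`,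
`(β − l)(β − ρ) Σ_{i∈s} |⟪e_i, x⟫|² ≤ ‖Tx‖² − ρ²`
(from `Σ_i |⟪e_i,x⟫|² (λ_i − l)(λ_i − ρ) = ‖Tx‖² − ρ²`, all terms `≥ 0`, and
`(λ_i − l)(λ_i − ρ) ≥ (β − l)(β − ρ)` for `λ_i ≥ β`). With `l = λ₁ ≤ ρ` this gives
`Σ_{λ_i ≥ β} |⟪e_i,x⟫|² ≤ (‖Tx‖² − ρ²)/(β − ρ)²`: the trial vector is close to the bottom eigenspace.
[folklore] -/
theorem sum_coeff_sq_upper_le (hsym : ∀ x y : E, ⟪T x, y⟫_𝕜 = ⟪x, T y⟫_𝕜)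
    (hT : ∀ i, T (b i) = (ev i : 𝕜) • b i) {l β : ℝ} (hgap : ∀ i, ev i ≤ l ∨ β ≤ ev i)
    {x : E} (hx : ‖x‖ = 1) (s : Finset ι) (hs : ∀ i ∈ s, β ≤ ev i) (hρl : l ≤ RCLike.re ⟪x, T x⟫_𝕜)
    (hρβ : RCLike.re ⟪x, T x⟫_𝕜 ≤ β) :
    (β - l) * (β - RCLike.re ⟪x, T x⟫_𝕜) * ∑ i ∈ s, ‖⟪b i, x⟫_𝕜‖ ^ 2 ≤
      ‖T x‖ ^ 2 - (RCLike.re ⟪x, T x⟫_𝕜) ^ 2 := by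
  classical
  set ρ := RCLike.re ⟪x, T x⟫_𝕜 with hρ
  have h0 := hasSum_norm_inner_sq b x
  have h1 := hasSum_eigen_norm_sq b hsym hT x
  have h2 := hasSum_eigen_sq_norm_sq b hsym hT x
  rw [hx, one_pow] at h0
  have hsum2 : HasSum (fun i => ‖⟪b i, x⟫_𝕜‖ ^ 2 * ((ev i - l) * (ev i - ρ))) (‖T x‖ ^ 2 - ρ ^ 2) := by
    have := (h2.sub (h1.mul_left (l + ρ))).add (h0.mul_left (l * ρ))
    have hfun : (fun i => ‖⟪b i, x⟫_𝕜‖ ^ 2 * ((ev i - l) * (ev i - ρ))) =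
        fun i => ev i ^ 2 * ‖⟪b i, x⟫_𝕜‖ ^ 2 - (l + ρ) * (ev i * ‖⟪b i, x⟫_𝕜‖ ^ 2)
          + l * ρ * ‖⟪b i, x⟫_𝕜‖ ^ 2 := by
      funext i; ring
    rw [hfun, show ‖T x‖ ^ 2 - ρ ^ 2 = ‖T x‖ ^ 2 - (l + ρ) * ρ + l * ρ * 1 by ring]
    exact this
  have hnn2 : ∀ i, 0 ≤ ‖⟪b i, x⟫_𝕜‖ ^ 2 * ((ev i - l) * (ev i - ρ)) := by
    intro i
    refine mul_nonneg (sq_nonneg _) ?_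
    rcases hgap i with h | h
    · exact mul_nonneg_of_nonpos_of_nonpos (by linarith) (by linarith)
    · exact mul_nonneg (by linarith) (by linarith)
  have hfin2 := sum_le_hasSum s (fun i _ => hnn2 i) hsum2
  have hterm : ∀ i ∈ s, (β - l) * (β - ρ) * ‖⟪b i, x⟫_𝕜‖ ^ 2 ≤
      ‖⟪b i, x⟫_𝕜‖ ^ 2 * ((ev i - l) * (ev i - ρ)) := by
    intro i hi
    have hβi := hs i hi
    have hw : (β - l) * (β - ρ) ≤ (ev i - l) * (ev i - ρ) := by nlinarith
    nlinarith [sq_nonneg ‖⟪b i, x⟫_𝕜‖]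
  calc (β - l) * (β - ρ) * ∑ i ∈ s, ‖⟪b i, x⟫_𝕜‖ ^ 2
      = ∑ i ∈ s, (β - l) * (β - ρ) * ‖⟪b i, x⟫_𝕜‖ ^ 2 := by rw [Finset.mul_sum]
    _ ≤ ∑ i ∈ s, ‖⟪b i, x⟫_𝕜‖ ^ 2 * ((ev i - l) * (ev i - ρ)) := Finset.sum_le_sum hterm
    _ ≤ ‖T x‖ ^ 2 - ρ ^ 2 := hfin2

end Companions

end Literature.Analysis.OperatorTheory

end
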